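import Summits.BirchSwinnertonDyer.BirchSwinnertonDyer.Theorems.RamifiedHeegnerPairLeafUpperMembersOfReadingOptimalOffRows
import Summits.BirchSwinnertonDyer.BirchSwinnertonDyer.Theorems.SchneiderFreeUpperSocketsSplit
import HarnessLib

/-!
# Route `RamifiedHeegnerPair`, crux U₁ `LeafRankOneUpperAtThree` (stmt-BirchSwinnertonDyer-26022), line `splitkolyvagin` —
# the TWIST-UNIT road: U₁ WITHOUT the rank-zero lower member L₀

HONEST FRAMING. Theorems only; helper file (`--supports stmt-BirchSwinnertonDyer-26022`); nothing is booked, no item is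
closed, BSD is not proved for any curve; CONDITIONAL on every displayed input. Lead prover bsd-line-rhp-p2 g7, 2026-08-28.

WHY. In the registered composition of the line (skeleton v6; `…LeafRankOneUpperAtThreeOptimalMember` §5, glue item 27494
modulo L₀ by `…GlueOfLowerRankZero`) the route's declared-residual member L₀ = `Gss2LowerAtThreeRankZero` (item 26023,
«open problem: Kato ⊇ made index-exact at an additive potentially supersingular 3, in print for no class») enters at ONE
place only: Kolyvagin over a split Heegner field `K′` bounds `Ш(E/K′)[3^∞]`, i.e. the SUM of the `3`-parts of `Ш(E)` and
`Ш(E^{(d_{K′})})`, and to isolate `ord₃ #Ш(E) ≤ ord₃ #Ш_an(E)` the bookkeeping `missingUpperBoundAt_of_jointUpper_of_lower`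
spends the LOWER half of the rank-zero twist. The tree's TWIST-UNIT lever (`SchneiderFree.Upper.missingUpperBoundAt_of_
jointUpper_of_twistUnit`, cell `bsd-schneider`, used by the X3 / AKR doors, never by this route) replaces that input by a
CHOICE of the Heegner field: if the rank-zero twist has `ord₃ #Ш_an ≤ 0` its lower half is free (`0 ≤ ord₃ #Ш`). With the
door's split datum `SchneiderFree.Upper.TwistUnitFieldAt W 3` (a Heegner field `K` of `W` — odd `d_K`, Heegner hypothesis
for `N_W`, `L(W^{(d_K)},1) ≠ 0` — and a member `W₂ ∼ W` whose `d_K`-twist has `3`-unit analytic `Ш`; per curve an EXACT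
finite certificate by modular symbols) this file proves:

* §1 `missingLowerBoundAt_twistModel_of_unitMember` — the unit at ANY member's twist gives the LOWER half of every
  globally minimal model of `W^{(d_K)}` (Cassels' invariance of the BSD quotient + GZK + Version L: the defect
  `ord₃ #Ш − ord₃ #Ш_an` is a class invariant, `missingLowerBoundAt_of_isIsogenous_of_analyticRank_le_one`; twists of
  isogenous curves are isogenous, `IsIsogenous.quadraticTwist`).
* §2 `leafRankOneUpper_three_of_sigmaAtDatum_of_twistUnit` — U₁ AT `W` from Σ AT ONE DATUM over the twist-unit field: the
  datum-level composition `…_of_sigmaAtDatum_of_lowerRankZero` (p610955) with (Friedberg–Hoffstein, L₀) ↦ (Cassels, the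
  twist-unit datum at `W`).
* §3 `leafRankOneUpper_three_tamFree_of_print_of_twistUnit` — the TAMAGAWA-FREE rows: U₁ at `W` ⟸ SEVEN printed facts +
  the twist-unit datum at `W`. NO S2, NO Σ, NO L₀, NO image hypothesis.
* §4 `leafRankOneUpper_three_monoCarrier_of_divisibilityReading_of_twistUnit` — the mono-multiplicative-carrier rows:
  U₁ at `W` ⟸ print + S2 (item 27492 BY NAME) + the twist-unit datum.
* §5 `leafRankOneUpper_three_of_latticeOptimal_of_divisibilityReading_of_sigmaStar_of_twistUnit` — at a lattice-optimal
  member: print⁺ + S2 + Σ★″ (item 27493 BY NAME) + the twist-unit datum.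
* §6 `leafRankOneUpperAtThree_of_pubManin_of_divisibilityReading_of_sigmaStar_of_twistUnit` — the route decl
  `LeafRankOneUpperAtThree` BY NAME from PUB⁺ (27491) ∧ S2 (27492) ∧ Σ★″ (27493) ∧ TU₁, and
  `leafRankOneUpperAtThreeGlue_of_twistUnit : TU₁ → LeafRankOneUpperAtThreeGlue` (item 27494's decl, the twin of
  p626516's `…Glue_of_lowerRankZero`), where
  TU₁ := `∀ W` non-CM leaf (`Addv W 3`, `SubGss W 3`) with `r_an(W) = 1`, `SchneiderFree.Upper.TwistUnitFieldAt W 3`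
  — the Gss2 rank-one analogue of route `SchneiderFreeAdditiveX3Upper`'s crux `TwistUnitX3OffSliver` (item 20364).

WHAT THIS SAYS (for the pen; numbers, not adjectives). Modulo print, U₁ ⟸ S2 ∧ Σ★″ ∧ (L₀ ∨ TU₁): the rank-one upper member
no longer waits on the rank-zero lower member. TU₁ is NOT print (Ono–Skinner 1998 / Prasanna 2010 / Burungale–Hida–Tian
2017 exclude `p = 3 ∣ N`; X3 files its twin as difficulty open-problem «equidistribution mod p»), so this is an
ALTERNATIVE fourth stub, not a discharge; its advantage over L₀ is that it is decidable per class by an exact finite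
computation (one Heegner discriminant with `3 ∤ #Ш_an(E^{(d)})`), so every rung / census certificate of U₁ can be cut free of
L₀. BSD is not proved; U₁, L₀ and TU₁ are OPEN.

References: [cite: MilneADT2006, Thm. I.7.3 and Remark I.7.4] [cite: Cassels1965ArithmeticVIII] [cite: Miller2011LMS, §1 and
Def. 1.1] [cite: GrossZagier1986, Thm. I.(6.3) and (7.3)] [cite: MatarNekovar2019, Thm. 0.7 (p. 456) and §0.11 (p. 457)]
[cite: Jetchev2008, Conj. 1.3, Thm. 1.4, Cor. 1.5 (p. 812)] [cite: KrizLi2019, Thm. 1.20] [cite: CremonaAlgorithms1997, §3.9 (p. 87)]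
[cite: OnoSkinner1998, Cor. 2 (p. 652)] [cite: Mazur1978, Cor. 4.1].
-/

-- D-0017: single-problem summit, so `Summit.BirchSwinnertonDyer.BirchSwinnertonDyer.…` repeats a namespace BY DESIGN.
set_option linter.dupNamespace false
set_option autoImplicit false

noncomputable section

open scoped Classical NumberField

open WeierstrassCurve IsDedekindDomain IsDedekindDomain.HeightOneSpectrum NumberField
  Rat.HeightOneSpectrum Literature Literature.NumberTheory.EllipticCurves
  Literature.NumberTheory.EllipticCurves.ModularForms
  Literature.NumberTheory.EllipticCurves.Rank1Residual
  Literature.NumberTheory.EllipticCurves.Rank1Residual.Typed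
  Literature.NumberTheory.EllipticCurves.KrizLi2019
  Literature.NumberTheory.QuadraticFields
  Summit.BirchSwinnertonDyer.Rank1Residual
  Summit.BirchSwinnertonDyer.Rank1Residual.Additive
  Summit.BirchSwinnertonDyer.Rank1Residual.X11b.Three
  Summit.BirchSwinnertonDyer.BirchSwinnertonDyer.Theses.RamifiedHeegnerPair
  Summit.BirchSwinnertonDyer.BirchSwinnertonDyer.Theorems
  Summit.BirchSwinnertonDyer.BirchSwinnertonDyer.Theorems.SchneiderFree

namespace Summit.BirchSwinnertonDyer.BirchSwinnertonDyer.Theorems.RamifiedPairUpperBound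

/-! ## §1 The unit at any member's twist gives the LOWER half of every model of the twist -/

/-- **A `p`-unit analytic `Ш` pays the lower half for free**: `#Ш_an(V) = q` with `ord_p q ≤ 0` gives
`Typed.MissingLowerBoundAt V p` (`0 ≤ ord_p #Ш(V)`). Bookkeeping. [cite: Miller2011LMS, §1 and Def. 1.1 (arXiv:1010.2431 p. 3)] -/
theorem missingLowerBoundAt_of_padicValRat_shaAn_nonpos {V : WeierstrassCurve ℚ} {p : ℕ} {q : ℚ}
    (hq : shaAn V = (q : ℂ)) (hv : padicValRat p q ≤ 0) : MissingLowerBoundAt V p :=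
  ⟨q, hq, hv.trans (by exact_mod_cast Nat.zero_le _)⟩

/-- **The split twist-unit datum at `W` pays the LOWER half of every globally minimal model of the twist `W^{(d_K)}`**, for
the field `K` it names. Data: `W ∼ W₂` over `ℚ`, `d ≠ 0`, a globally minimal model `W₂d` of `W₂^{(d)}` with `#Ш_an(W₂d) = q`,
`ord_p q ≤ 0`, and a globally minimal model `Cd • W^{(d)}` of analytic rank `≤ 1`. Then `Typed.MissingLowerBoundAt (Cd • W^{(d)}) p`:
the two models are `ℚ`-isogenous (twisting commutes with isogenies, `IsIsogenous.quadraticTwist`; models are isomorphic),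
and the lower half transports along the isogeny by Cassels' invariance of the BSD quotient (`hCassels`) with `Ш(W₂d)`
finite (GZK, `hGZK`) and `L*(W₂d,1) ≠ 0` (Version L, `hmod`) — `missingLowerBoundAt_of_isIsogenous_of_analyticRank_le_one`.
[cite: MilneADT2006, Thm. I.7.3 and Remark I.7.4] [cite: CremonaAlgorithms1997, §3.9 (p. 87)] [cite: Miller2011LMS, Def. 1.1] -/
theorem missingLowerBoundAt_twistModel_of_unitMember (hCassels : bsdRHS_eq_of_isIsogenous)
    (hGZK : rank_eq_analyticRank_of_analyticRank_le_one) (hmod : hasEntireLFunction_rat) {p : ℕ} [Fact p.Prime]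
    {W W₂ W₂d : WeierstrassCurve ℚ} [W₂d.IsElliptic] [W₂d.IsGloballyMinimal] (hiso : IsIsogenous W W₂) {d : ℚ} (hd : d ≠ 0)
    {C : VariableChange ℚ} (hC : C • W₂.quadraticTwist d = W₂d) (Cd : VariableChange ℚ)
    [(Cd • W.quadraticTwist d).IsElliptic] [(Cd • W.quadraticTwist d).IsGloballyMinimal]
    (hr : (Cd • W.quadraticTwist d).analyticRank ≤ 1) {q : ℚ} (hq : shaAn W₂d = (q : ℂ)) (hv : padicValRat p q ≤ 0) :
    MissingLowerBoundAt (Cd • W.quadraticTwist d) p := by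
  have hiso_d : IsIsogenous (Cd • W.quadraticTwist d) W₂d := by
    rw [← hC]
    exact IsIsogenous.trans' (isIsogenous_of_smul _ Cd)
      (IsIsogenous.trans' (hiso.quadraticTwist hd) (isIsogenous_smul _ C))
  exact missingLowerBoundAt_of_isIsogenous_of_analyticRank_le_one hCassels hGZK hmod hr hiso_d
    (missingLowerBoundAt_of_padicValRat_shaAn_nonpos hq hv)

/-! ## §2 One datum: U₁ at `W` from Σ at the datum over the TWIST-UNIT field (no L₀) -/

/-- **U₁ AT `W` from Σ AT ONE PARAMETRISATION DATUM over the twist-unit field — L₀-FREE.** For a non-CM leaf `W`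
(`Addv W 3`, `SubGss W 3`) of analytic rank one, a parametrisation datum `Dt` at level `N_E`, and the split twist-unit datum
`SchneiderFree.Upper.TwistUnitFieldAt W 3` (`hTU`): IF for every imaginary quadratic `K′` of odd discriminant with the Heegner
hypothesis for `N_E` and `L(W^{(d_{K′})},1) ≠ 0`, every Heegner datum `H`, `ι`, and the (non-torsion) Heegner point `P`, the
derived Heegner points on the frame `(Dt, H.β, ι)` are `3^{s′}`-divisible for all `s′ ≤ ord₃ ∏c_ℓ(W) + v₃(c(Dt))` (`hSig`, Σ at
`Dt`), THEN `Typed.MissingUpperBoundAt W 3` — given the printed facts `hGZ hKo hGZK hmod hGZ73 hMN` and Cassels' invariance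
`hCassels`. Proof = p610955's `leafRankOneUpper_three_of_sigmaAtDatum_of_lowerRankZero` with the Friedberg–Hoffstein field
replaced by the twist-unit field and the twist's lower half supplied by §1 instead of the route item L₀; the receptacle is
p607279's `leafRankOneUpper_three_of_globalDivisibility_of_twistLower`. CONDITIONAL on every displayed input; nothing asserted
about any curve. [cite: GrossZagier1986, Thm. I.(6.3) and (7.3)] [cite: MatarNekovar2019, Thm. 0.7 (p. 456)]
[cite: Jetchev2008, Conj. 1.3 (p. 812)] [cite: MilneADT2006, Thm. I.7.3] [cite: Miller2011LMS, Def. 1.1] -/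
theorem leafRankOneUpper_three_of_sigmaAtDatum_of_twistUnit
    (hGZ : ∀ (N : ℕ) [NeZero N] (W : WeierstrassCurve ℚ) (K : Type) [Field K] [NumberField K],
      gross_zagier N W K)
    (hKo : ∀ (N : ℕ) [NeZero N] (W : WeierstrassCurve ℚ) (K : Type) [Field K] [NumberField K],
      kolyvagin N W K)
    (hGZK : rank_eq_analyticRank_of_analyticRank_le_one) (hmod : hasEntireLFunction_rat)
    (hGZ73 : GrossZagier1986_thm_I_7_3)
    (hMN : MatarNekovar2019.thm07_padicValNat_card_sha_primary_add_le_of_globalDivisibility_of_irreducible)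
    (hCassels : bsdRHS_eq_of_isIsogenous)
    (W : WeierstrassCurve ℚ) [W.IsElliptic] [W.IsGloballyMinimal] [NeZero (W.conductorNorm ℤ)]
    (hCM : ¬ W.HasCM) (hadd : Addv W 3) (hsub : SubGss W 3) (hr : W.analyticRank = 1)
    (Dt : ModularParametrizationData W (W.conductorNorm ℤ)) (hTU : Upper.TwistUnitFieldAt W 3)
    (hSig : ∀ (K : Type) [Field K] [NumberField K]
      (H : HeegnerDatum (W.conductorNorm ℤ) (NumberField.discr K)) (ι : K →+* ℂ) (P : (W.baseChange K).toAffine.Point),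
      IsImaginaryQuadratic K → SatisfiesHeegnerHypothesis (W.conductorNorm ℤ) K →
      (W.quadraticTwist (NumberField.discr K : ℚ)).entireLFunction 1 ≠ 0 →
      WeierstrassCurve.Affine.Point.map ι.toRatAlgHom P = heegnerPointComplex Dt H → ¬ IsOfFinAddOrder P →
      Odd (NumberField.discr K) →
      ∀ (s' : ℕ), s' ≤ padicValNat 3 W.tamagawaProduct + padicValNat 3 Dt.c.natAbs →
      ∀ (n : ℕ) (d : KolyvaginHeegnerData Dt H.β ι n), Squarefree n →
      (∀ ℓ ∈ n.primeFactors, Zhang2014.IsKolyvaginPrime (W.conductorNorm ℤ) W K 3 ℓ ∧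
        s' ≤ Zhang2014.kolyvaginIndex W 3 ℓ) → Koly.PDiv d 3 s') :
    MissingUpperBoundAt W 3 := by
  -- the twist-unit field `K` of `W` and the unit member `W₂ ∼ W` with its twist model `W₂d`
  obtain ⟨K, _, _, W₂, W₂d, _, _, _, _, hK, hodd, hHN, hLt, hiso, ⟨C, hC⟩, qd, hqd, hv⟩ := hTU
  -- the Heegner datum and the `K`-rational Heegner point of `Dt`
  obtain ⟨β, hβ⟩ := exists_dvd_sq_sub_discr_holds (W.conductorNorm ℤ) K hK hHN
  obtain ⟨H, -⟩ := nonempty_heegnerDatum_holds (W.conductorNorm ℤ) K hK hβ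
  obtain ⟨ι⟩ : Nonempty (K →+* ℂ) := inferInstance
  obtain ⟨P, hP⟩ := heegnerPointComplex_mem_range_map_holds (W.conductorNorm ℤ) W K hK hHN Dt H ι
  -- a globally minimal model of the twist, of analytic rank `0`; its lower half from the unit member (§1)
  have hD0 : (NumberField.discr K : ℚ) ≠ 0 := by exact_mod_cast NumberField.discr_ne_zero K
  haveI hEt : (W.quadraticTwist (NumberField.discr K : ℚ)).IsElliptic := W.isElliptic_quadraticTwist hD0
  obtain ⟨Cd, hCd⟩ := hasGlobalMinimalModel_rat_holds (W.quadraticTwist (NumberField.discr K : ℚ))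
  haveI : (Cd • W.quadraticTwist (NumberField.discr K : ℚ)).IsGloballyMinimal := hCd
  have hrd : (Cd • W.quadraticTwist (NumberField.discr K : ℚ)).analyticRank = 0 := by
    rw [analyticRank_smul]
    exact analyticRank_eq_zero_of_entireLFunction_one_ne_zero _ hLt
  have hlow : MissingLowerBoundAt (Cd • W.quadraticTwist (NumberField.discr K : ℚ)) 3 :=
    missingLowerBoundAt_twistModel_of_unitMember hCassels hGZK hmod hiso hD0 hC Cd (by omega) hqd hv
  -- the Heegner point is non-torsion (Gross–Zagier: `L′(E/K,1) = L′(E,1)·L(E^{(d_K)},1) ≠ 0`)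
  have hL0W : W.entireLFunction 1 = 0 := entireLFunction_one_eq_zero_of_analyticRank_eq_one hr
  obtain ⟨-, hderiv⟩ := leadingLCoeff_eq_deriv_of_analyticRank_eq_one hr
  have hLK : LDerivEK W K ≠ 0 := by
    rw [lDerivEK_eq_deriv_mul W K hmod hL0W]; exact mul_ne_zero hderiv hLt
  have hnt : ¬ IsOfFinAddOrder P :=
    (lDerivEK_ne_zero_iff_not_isOfFinAddOrder W (W.conductorNorm ℤ) K (hGZ _ W K) hK hHN
      ⟨Dt, H, ι, hP⟩).mp hLK
  -- Σ at this datum ⟹ the socket (p607279's receptacle) ⟹ the upper half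
  exact leafRankOneUpper_three_of_globalDivisibility_of_twistLower hGZ hKo hGZK hmod hGZ73 hMN W hCM hadd hsub hr
    K Dt H ι P (Cd • W.quadraticTwist (NumberField.discr K : ℚ)) hK hodd hHN hLt hP ⟨Cd, rfl⟩
    (fun s' hs' n d hn hℓ ↦ hSig K H ι P hK hHN hLt hP hnt hodd s' hs' n d hn hℓ) hlow

/-! ## §3 The Tamagawa-free rows: U₁ ⟸ seven printed facts + the twist-unit datum (no S2, no Σ, no L₀, image-free) -/

/-- **U₁ on the TAMAGAWA-FREE rows from PRINT + the twist-unit datum ALONE.** For a non-CM leaf curve `W` (`Addv W 3`,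
`SubGss W 3`) of analytic rank one with `3 ∤ ∏_ℓ c_ℓ(W)` and a parametrisation datum at level `N_E` with `3 ∤ c`: the depth
of Σ is `0`, so `Typed.MissingUpperBoundAt W 3` follows from the printed facts (Gross–Zagier ∀, Kolyvagin ∀, GZK, Version L,
GZ I.(7.3), Matar–Nekovář 2019 Thm. 0.7 in the irreducible form — no surjectivity —, Cassels' isogeny invariance) and the
split twist-unit datum at `W`. Compared with p610955 §3 the route item L₀ (26023) and Friedberg–Hoffstein are GONE.
[cite: MatarNekovar2019, Thm. 0.7 (p. 456) and §0.11 (p. 457)] [cite: GrossZagier1986, Thm. I.(6.3) and (7.3)]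
[cite: MilneADT2006, Thm. I.7.3] [cite: Miller2011LMS, Def. 1.1] -/
theorem leafRankOneUpper_three_tamFree_of_print_of_twistUnit
    (hGZ : ∀ (N : ℕ) [NeZero N] (W : WeierstrassCurve ℚ) (K : Type) [Field K] [NumberField K],
      gross_zagier N W K)
    (hKo : ∀ (N : ℕ) [NeZero N] (W : WeierstrassCurve ℚ) (K : Type) [Field K] [NumberField K],
      kolyvagin N W K)
    (hGZK : rank_eq_analyticRank_of_analyticRank_le_one) (hmod : hasEntireLFunction_rat)
    (hGZ73 : GrossZagier1986_thm_I_7_3)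
    (hMN : MatarNekovar2019.thm07_padicValNat_card_sha_primary_add_le_of_globalDivisibility_of_irreducible)
    (hCassels : bsdRHS_eq_of_isIsogenous)
    (W : WeierstrassCurve ℚ) [W.IsElliptic] [W.IsGloballyMinimal] [NeZero (W.conductorNorm ℤ)]
    (hCM : ¬ W.HasCM) (hadd : Addv W 3) (hsub : SubGss W 3) (hr : W.analyticRank = 1)
    (htam : ¬ 3 ∣ W.tamagawaProduct)
    (Dt : ModularParametrizationData W (W.conductorNorm ℤ)) (hc : ¬ (3 : ℤ) ∣ Dt.c) (hTU : Upper.TwistUnitFieldAt W 3) :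
    MissingUpperBoundAt W 3 := by
  have ht0 : padicValNat 3 W.tamagawaProduct = 0 := padicValNat.eq_zero_of_not_dvd htam
  have hc0 : padicValNat 3 Dt.c.natAbs = 0 :=
    padicValNat.eq_zero_of_not_dvd fun h ↦ hc (Int.ofNat_dvd_left.mpr h)
  refine leafRankOneUpper_three_of_sigmaAtDatum_of_twistUnit hGZ hKo hGZK hmod hGZ73 hMN hCassels W hCM hadd hsub hr
    Dt hTU ?_
  intro K _ _ H ι P _ _ _ _ _ _ s' hs' n d _ _
  have hs0 : s' = 0 := by omega
  subst hs0
  exact koly_pDiv_zero d 3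

/-! ## §4 The mono-multiplicative-carrier rows: U₁ ⟸ print + S2 + the twist-unit datum (no L₀) -/

/-- **U₁ AT `W` ON A MONO-MULTIPLICATIVE-CARRIER ROW WITH A MANIN-CLEAN DATUM, from S2 and the twist-unit datum.** Data: `W/ℚ`
globally minimal, non-CM, leaf Gss2 at `3`, `r_an(W) = 1`; a prime `q ∥ N_E` carrying the whole `3`-part of the Tamagawa product;
the global Tamagawa binder of the reading (`htam`); a parametrisation datum `Dt` at level `N_E` with `3 ∤ c(Dt)`; the split
twist-unit datum at `W`. DISPLAYED INPUT `hD` = S2, the route item `JetchevDivisibilityReadingS2` (27492) BY NAME — the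
divisibility reading of Jetchev 2008 Thm. 1.4 at ONE multiplicative Tamagawa carrier. Proof = p615347 §2
(`leafRankOneUpper_three_monoCarrier_of_divisibilityReading_of_lowerRankZero`) over §2 instead of p610955 §1: depth `0` free,
at positive depth `q ≠ 3` (`3 ∤ c₃` on the leaf), `d_K ∉ {−3, −4}` from the Heegner hypothesis at `3 ∣ N_E` and `d_K` odd, the
conductor-`1` datum with bottom point `P` (Darmon 3.6 / Shimura reciprocity, tree theorems). CONDITIONAL on `hD`, the named
facts and the twist-unit datum; nothing asserted about any curve. [cite: Jetchev2008, Thm. 1.4 and Cor. 1.5 (p. 812), Thm. 6.3]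
[cite: MatarNekovar2019, Thm. 0.7 (p. 456) and §0.11 (p. 457)] [cite: GrossZagier1986, Thm. I.(6.3) and (7.3)] [cite: Miller2011LMS, Def. 1.1] -/
theorem leafRankOneUpper_three_monoCarrier_of_divisibilityReading_of_twistUnit
    (hGZ : ∀ (N : ℕ) [NeZero N] (W : WeierstrassCurve ℚ) (K : Type) [Field K] [NumberField K],
      gross_zagier N W K)
    (hKo : ∀ (N : ℕ) [NeZero N] (W : WeierstrassCurve ℚ) (K : Type) [Field K] [NumberField K],
      kolyvagin N W K)
    (hGZK : rank_eq_analyticRank_of_analyticRank_le_one) (hmod : hasEntireLFunction_rat)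
    (hGZ73 : GrossZagier1986_thm_I_7_3)
    (hMN : MatarNekovar2019.thm07_padicValNat_card_sha_primary_add_le_of_globalDivisibility_of_irreducible)
    (hCassels : bsdRHS_eq_of_isIsogenous) (hD : JetchevDivisibilityReadingS2)
    (W : WeierstrassCurve ℚ) [W.IsElliptic] [W.IsGloballyMinimal] [NeZero (W.conductorNorm ℤ)]
    (hCM : ¬ W.HasCM) (hadd : Addv W 3) (hsub : SubGss W 3) (hr : W.analyticRank = 1)
    (q : ℕ) [Fact q.Prime] (hqN : q ∣ W.conductorNorm ℤ) (hq2 : ¬ q ^ 2 ∣ W.conductorNorm ℤ)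
    (hmono : padicValNat 3 W.tamagawaProduct ≤ padicValNat 3 ((W.baseChange ℚ_[q]).localTamagawaNumber ℤ_[q]))
    (htam : ∀ (q' : ℕ) [Fact q'.Prime], q' ∣ W.conductorNorm ℤ →
      3 ∣ (W.baseChange ℚ_[q']).localTamagawaNumber ℤ_[q'] → ¬ q' ^ 2 ∣ W.conductorNorm ℤ)
    (Dt : ModularParametrizationData W (W.conductorNorm ℤ)) (hc : ¬ (3 : ℤ) ∣ Dt.c) (hTU : Upper.TwistUnitFieldAt W 3) :
    MissingUpperBoundAt W 3 := by
  -- the leaf discharges the reading's local binders at `p = 3`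
  have hirr : W.HasIrreducibleModPGaloisRep 3 := (classX4_three_of_addv_of_subGss W hadd hsub).2.2
  have hj : 0 ≤ padicValRat 3 W.j := padicValRat_j_nonneg_of_subGss_three W hadd hsub
  have hc3 : ¬ 3 ∣ (W.baseChange ℚ_[3]).localTamagawaNumber ℤ_[3] :=
    not_three_dvd_localTamagawaNumber_three_of_subGss W hadd hsub
  have h3N : 3 ∣ W.conductorNorm ℤ :=
    (W.dvd_conductorNorm_iff_not_hasGoodReductionAtPrime 3).mpr (not_good_of_addv W 3 hadd)
  refine leafRankOneUpper_three_of_sigmaAtDatum_of_twistUnit hGZ hKo hGZK hmod hGZ73 hMN hCassels W hCM hadd hsub hr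
    Dt hTU ?_
  intro K _ _ H ι P hK hHN hLt hP hnt hodd s' hs' n d hn hℓ
  -- depth `0` is free
  rcases Nat.eq_zero_or_pos s' with hs0 | hspos
  · subst hs0
    exact koly_pDiv_zero d 3
  -- positive depth: `3 ∣ c_q`, so the carrier `q` is not `3`
  have hc0 : padicValNat 3 Dt.c.natAbs = 0 :=
    padicValNat.eq_zero_of_not_dvd fun h ↦ hc (Int.ofNat_dvd_left.mpr h)
  have hsq : s' ≤ padicValNat 3 ((W.baseChange ℚ_[q]).localTamagawaNumber ℤ_[q]) := by omega
  have hq3 : q ≠ 3 := by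
    rintro rfl
    have hpos : 0 < padicValNat 3 ((W.baseChange ℚ_[3]).localTamagawaNumber ℤ_[3]) := by omega
    exact hc3 (dvd_of_one_le_padicValNat hpos)
  -- `d_K ∉ {-3, -4}`: `3 ∣ N_E` splits in `K`, `d_K` odd
  have h3 : NumberField.discr K ≠ -3 := by
    intro h
    exact (X11b.Three.not_dvd_discr_and_not_dvd_torsionOrder_of_heegner hK hHN (by decide) h3N).1
      (h ▸ ⟨-1, by norm_num⟩)
  have h4 : NumberField.discr K ≠ -4 := by
    intro h
    rw [h] at hodd
    exact (Int.not_odd_iff_even.mpr ⟨-2, by norm_num⟩) hodd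
  -- the conductor-`1` Kolyvagin–Heegner datum on the frame, with bottom point `P` (Darmon 3.6 / Shimura, proved)
  obtain ⟨d₁⟩ := exists_kolyvaginHeegnerData_one
    (phi_heegnerTau_mem_singularModuliField_holds (W.conductorNorm ℤ) W K) hK Dt H.β ι H.dvd_sq_sub
  have hPd : d₁.toGeomPoints d₁.derivedPoint = toGeomPoints (W.baseChange K) P :=
    X11b.KolyvaginBottom.toGeomPoints_derivedPoint_one_eq
      (heegnerPointOfConductor_one_galoisConj_holds (W.conductorNorm ℤ) W K) hK hHN hP d₁ rfl
  have hy₁ : ¬ IsOfFinAddOrder d₁.derivedPoint := by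
    intro hfin
    apply hnt
    have h1 : IsOfFinAddOrder (d₁.toGeomPoints d₁.derivedPoint) := d₁.toGeomPoints.isOfFinAddOrder hfin
    rw [hPd] at h1
    exact (toGeomPoints_injective (W.baseChange K)).isOfFinAddOrder_iff.mp h1
  -- S2 at `p = 3`, carrier `q`, depth `s'`
  exact hD W hCM K hK h3 h4 hHN 3 (by decide) hadd hj hirr hc3 htam Dt H.β ι d₁ hy₁ q hqN hq2 hq3 s' hsq n d hn hℓ

/-! ## §5 At a lattice-optimal member: U₁ ⟸ print⁺ + S2 + Σ★″ + the twist-unit datum (no Manin clause, no L₀) -/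

/-- **U₁ AT A LEAF CURVE CARRYING A LATTICE-OPTIMAL DATUM ⟸ print⁺ + S2 + Σ★″ + the twist-unit datum at that curve.** Inputs:
the printed facts, Cassels' invariance, the three printed Manin facts (Mazur 1978 Cor. 4.1, Abbes–Ullmo 1996 Thm. A, Česnavičius
2018 Thm. 1.2) and modularity (newform) for `3 ∤ c` at a lattice-optimal datum of a leaf curve (`not_three_dvd_c_of_latticeOptimal_
of_subGss`); S2 = item 27492 BY NAME; Σ★″ = item 27493 BY NAME (orientation-free; weakened to the rank-one orientation at the
point of use); the twist-unit datum at `W`. Case split on the mono-multiplicative-carrier row predicate exactly as p621612 §4: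
ON the row §4, OFF the row §2 with Σ★″ at `Dt`. CONDITIONAL on every displayed input; nothing asserted about any curve.
[cite: Jetchev2008, Conj. 1.3, Thm. 1.4 (p. 812)] [cite: MatarNekovar2019, Thm. 0.7 (p. 456)] [cite: Mazur1978, Cor. 4.1]
[cite: Stevens1989, Lemmas (5.2), (5.4)] [cite: GrossZagier1986, Thm. I.(6.3) and (7.3)] [cite: Miller2011LMS, Def. 1.1] -/
theorem leafRankOneUpper_three_of_latticeOptimal_of_divisibilityReading_of_sigmaStar_of_twistUnit
    (hGZ : ∀ (N : ℕ) [NeZero N] (W : WeierstrassCurve ℚ) (K : Type) [Field K] [NumberField K],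
      gross_zagier N W K)
    (hKo : ∀ (N : ℕ) [NeZero N] (W : WeierstrassCurve ℚ) (K : Type) [Field K] [NumberField K],
      kolyvagin N W K)
    (hGZK : rank_eq_analyticRank_of_analyticRank_le_one) (hmod : hasEntireLFunction_rat)
    (hGZ73 : GrossZagier1986_thm_I_7_3)
    (hMN : MatarNekovar2019.thm07_padicValNat_card_sha_primary_add_le_of_globalDivisibility_of_irreducible)
    (hnf : exists_isNewformOf) (hCassels : bsdRHS_eq_of_isIsogenous)
    (hM : mazur_not_dvd_maninConstant_of_odd) (hAU : abbesUllmo_not_dvd_maninConstant_of_not_dvd_level)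
    (hC2 : cesnavicius_not_two_dvd_maninConstant_of_two_dvd_level)
    (hD : JetchevDivisibilityReadingS2) (hStar : LeafSigmaStarDivisibilityAtThreeOptimalOffRows)
    (W : WeierstrassCurve ℚ) [W.IsElliptic] [W.IsGloballyMinimal] [NeZero (W.conductorNorm ℤ)]
    (hCM : ¬ W.HasCM) (hadd : Addv W 3) (hsub : SubGss W 3) (hr : W.analyticRank = 1)
    (Dt : ModularParametrizationData W (W.conductorNorm ℤ))
    (hopt : ∀ z ∈ Dt.L.lattice, ∃ w ∈ periodLattice Dt.f, z = Dt.c * w) (hTU : Upper.TwistUnitFieldAt W 3) :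
    MissingUpperBoundAt W 3 := by
  by_cases hrow : ((∃ (q : ℕ) (_ : Fact q.Prime), q ∣ W.conductorNorm ℤ ∧ ¬ q ^ 2 ∣ W.conductorNorm ℤ ∧
          padicValNat 3 W.tamagawaProduct ≤ padicValNat 3 ((W.baseChange ℚ_[q]).localTamagawaNumber ℤ_[q])) ∧
        (∀ (q' : ℕ) [Fact q'.Prime], q' ∣ W.conductorNorm ℤ →
          3 ∣ (W.baseChange ℚ_[q']).localTamagawaNumber ℤ_[q'] → ¬ q' ^ 2 ∣ W.conductorNorm ℤ))
  · obtain ⟨⟨q, _, hqN, hq2, hmono⟩, htam⟩ := hrow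
    exact leafRankOneUpper_three_monoCarrier_of_divisibilityReading_of_twistUnit hGZ hKo hGZK hmod hGZ73 hMN hCassels hD W
      hCM hadd hsub hr q hqN hq2 hmono htam Dt (not_three_dvd_c_of_latticeOptimal_of_subGss hM hAU hC2 hnf W Dt hopt hadd hsub)
      hTU
  · exact leafRankOneUpper_three_of_sigmaAtDatum_of_twistUnit hGZ hKo hGZK hmod hGZ73 hMN hCassels W hCM hadd hsub hr Dt hTU
      (fun K _ _ H ι P hK hHN hLt hP hnt hodd s' hs' n d hn hℓ ↦
        sigmaOptOffRows_of_sigmaStarOptOffRows hStar W (W.conductorNorm ℤ) K Dt H ι P hCM hadd hsub hr rfl hopt hrow hK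
          hHN hLt hP hnt hodd s' hs' n d hn hℓ)

/-! ## §6 The class statement BY NAME: `LeafRankOneUpperAtThree` ⟸ PUB⁺ ∧ S2 ∧ Σ★″ ∧ TU₁, and the glue G₁ modulo TU₁ -/

/-- **`LeafRankOneUpperAtThree` (item 26022) BY NAME ⟸ PUB⁺ (item 27491) ∧ S2 (item 27492) ∧ Σ★″ (item 27493) ∧ TU₁**, where
TU₁ — the twist-unit supply on the rank-one leaf — is spelled inline: every non-CM leaf curve (`Addv W 3`, `SubGss W 3`) of
analytic rank one carries the split twist-unit datum `SchneiderFree.Upper.TwistUnitFieldAt W 3` (the Gss2 rank-one analogue of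
route `SchneiderFreeAdditiveX3Upper`'s crux `TwistUnitX3OffSliver`, item 20364). Proof: move to the optimal member `W₀ ∼ W`
(modularity alone, `exists_optimal_leaf_member`; `W₀` is again a non-CM leaf curve of analytic rank one, so TU₁ applies AT `W₀`),
settle U₁ at `W₀` by §5, transport back along the isogeny (Cassels + GZK + Version L). The route item L₀ (26023) is NOT used;
of PUB⁺ the Friedberg–Hoffstein conjunct and the parametrisation-existence conjunct are idle. CONDITIONAL on every displayed
input; U₁ stays OPEN; BSD is not proved. [cite: Jetchev2008, Conj. 1.3, Thm. 1.4 (p. 812)] [cite: MatarNekovar2019, Thm. 0.7 (p. 456)]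
[cite: Mazur1978, Cor. 4.1] [cite: MilneADT2006, Thm. I.7.3] [cite: KrizLi2019, Thm. 1.20] [cite: Miller2011LMS, Def. 1.1] -/
theorem leafRankOneUpperAtThree_of_pubManin_of_divisibilityReading_of_sigmaStar_of_twistUnit
    (hpub : LeafRankOnePrintedInputsAtThree) (hD : JetchevDivisibilityReadingS2)
    (hStar : LeafSigmaStarDivisibilityAtThreeOptimalOffRows)
    (hTU : ∀ (W : WeierstrassCurve ℚ) [W.IsElliptic] [W.IsGloballyMinimal], ¬ W.HasCM →
      Literature.NumberTheory.EllipticCurves.Rank1Residual.Addv W 3 →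
      Summit.BirchSwinnertonDyer.Rank1Residual.Additive.SubGss W 3 → W.analyticRank = 1 →
      Upper.TwistUnitFieldAt W 3) :
    LeafRankOneUpperAtThree := by
  intro W _ _ hCM hadd hsub hr
  obtain ⟨hGZ, hKo, hGZK, hmod, hGZ73, hMN, hnf, -, -, hCassels, hM, hAU, hC2⟩ := hpub
  obtain ⟨W₀, hW₀, hW₀', N, hN0, D₀, hiso, hN₀, -, hopt, hCM₀, hadd₀, hsub₀, hr₀⟩ :=
    exists_optimal_leaf_member hnf W hCM hadd hsub
  haveI := hW₀
  haveI := hW₀'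
  haveI := hN0
  -- settle U₁ at the optimal member `W₀`, where TU₁ applies
  have h₀ : MissingUpperBoundAt W₀ 3 := by
    subst hN₀
    exact leafRankOneUpper_three_of_latticeOptimal_of_divisibilityReading_of_sigmaStar_of_twistUnit hGZ hKo hGZK hmod hGZ73
      hMN hnf hCassels hM hAU hC2 hD hStar W₀ hCM₀ hadd₀ hsub₀ (hr₀.trans hr) D₀ hopt (hTU W₀ hCM₀ hadd₀ hsub₀ (hr₀.trans hr))
  -- and transport it back along `W ∼ W₀`
  exact missingUpperBoundAt_of_isIsogenous_of_analyticRank_le_one hCassels hGZK hmod (le_of_eq hr) hiso h₀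

/-- **G₁ modulo TU₁** (twin of p626516's `leafRankOneUpperAtThreeGlue_of_lowerRankZero`): the generated glue
`LeafRankOneUpperAtThreeGlue` (PUB⁺ → S2 → Σ★″ → U₁, item 27494) from the twist-unit supply TU₁ on the rank-one leaf INSTEAD
of the route's rank-zero lower member L₀. CONDITIONAL on TU₁ (hypothesis); closes nothing. [cite: Jetchev2008, Conj. 1.3 (p. 812)]
[cite: MatarNekovar2019, Thm. 0.7 (p. 456)] [cite: KrizLi2019, Thm. 1.20] [cite: Miller2011LMS, Def. 1.1] -/
theorem leafRankOneUpperAtThreeGlue_of_twistUnit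
    (hTU : ∀ (W : WeierstrassCurve ℚ) [W.IsElliptic] [W.IsGloballyMinimal], ¬ W.HasCM →
      Literature.NumberTheory.EllipticCurves.Rank1Residual.Addv W 3 →
      Summit.BirchSwinnertonDyer.Rank1Residual.Additive.SubGss W 3 → W.analyticRank = 1 →
      Upper.TwistUnitFieldAt W 3) :
    LeafRankOneUpperAtThreeGlue :=
  fun hP hS hSig ↦ leafRankOneUpperAtThree_of_pubManin_of_divisibilityReading_of_sigmaStar_of_twistUnit hP hS hSig hTU

end Summit.BirchSwinnertonDyer.BirchSwinnertonDyer.Theorems.RamifiedPairUpperBound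

end
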